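import Literature.NumberTheory.LFunctions.ConnesProlateGuessSturm
import Literature.NumberTheory.LFunctions.ConnesProlateGuessWindow
import HarnessLib

/-!
# Connes' Fact 6.4 RH-free: `prolateGuess_tendsto_riemannXi` from the prolate interface alone

This file completes the unconditional proof of `prolateGuess_tendsto_riemannXi`
(`4·M_λ(s) → Ξ(½ + s)` uniformly on `|Re s| ≤ α₀ < ½`, Connes 2026 §6.4 Fact 6.4 =
Connes–Consani–Moscovici 2025 Lemma 7.3) from the eight-field interface `IsProlateFunction`
(Sturm–Liouville eigenfunction of `W_λ`, `n` zeros, `L²`-normalised, `f(0) > 0`), with **no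
asymptotic input assumed**: the prolate → Hermite asymptotics are *proved*
(`ConnesProlateGuessSturm`: eigenvalue pinning `χ/λ² → 2π, 18π`; `ConnesProlateGuessWindow`:
Gronwall window comparison + turning-point tails ⇒ `λ|f(λ)| → 0`, `∫_0^λ|f − h_n| → 0`,
`∫_0^λ|f′ − h_n′|(1+x) → 0` uniformly), and fed into the limit argument
`prolateGuess_tendsto_riemannXi_of_deriv_tendsto`.

* `prolateGuessRatio_tendsto_of_L1`, `prolateGuess_tendsto_riemannXi_of_L1Limit`: the `L¹`
  versions of the ratio limit `ρ_λ → ρ` and of the assembly (the sup-norm hypotheses of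
  `prolateGuess_tendsto_riemannXi_of_hermiteLimit` replaced by `λ|f(λ)| → 0` and
  `∫_0^λ |f − h_n| → 0`);
* Hermite data: `h_n′ → 0`, `∫_0^∞ h_n² = 1/2` (Gaussian moments), the `L¹` limits;
* `prolateGuess_tendsto_riemannXi_rhFree : prolateGuess_tendsto_riemannXi`.
-/

noncomputable section

open Real Set MeasureTheory Filter Topology intervalIntegral

namespace Literature.NumberTheory.LFunctions

/-! ### `ρ_λ → ρ` and the assembly from `L¹` convergence -/

/-- If `∫_0^λ |f − g| ≤ δ` for a prolate (hence even) `f`, then `|∫_{−λ}^{λ} f − 2∫_0^λ g| ≤ 2δ`.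
[folklore] -/
theorem abs_integral_sub_two_mul_integral_le_of_L1 {lam : ℝ} {n : ℕ} {f : ℝ → ℝ} {g : ℝ → ℝ}
    (hf : IsProlateFunction lam n f) (hg : Continuous g) {δ : ℝ}
    (hδ : (∫ x in (0 : ℝ)..lam, |f x - g x|) ≤ δ) :
    |(∫ x in (-lam)..lam, f x) - 2 * ∫ x in (0 : ℝ)..lam, g x| ≤ 2 * δ := by
  have hlam := hf.lam_pos
  have hfi := hf.intervalIntegrable
  have hfi0 : IntervalIntegrable f volume 0 lam :=
    hfi.mono_set (by rw [uIcc_of_le hlam.le, uIcc_of_le (by linarith)]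
                     exact Icc_subset_Icc (by linarith) le_rfl)
  have hgi : IntervalIntegrable g volume 0 lam := hg.intervalIntegrable _ _
  rw [integral_neg_self_eq_two_mul_of_even hlam.le hf.even hfi, ← mul_sub, abs_mul,
    abs_of_pos two_pos, ← intervalIntegral.integral_sub hfi0 hgi]
  have hb : |∫ x in (0 : ℝ)..lam, (f x - g x)| ≤ ∫ x in (0 : ℝ)..lam, |f x - g x| :=
    intervalIntegral.abs_integral_le_integral_abs hlam.le
  linarith

/-- **`ρ_λ → ρ`** from the `L¹` asymptotics `∫_0^λ |h_{n,λ} − h_n| → 0` (`n = 0, 4`), uniformly over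
the prolate functions. [cite: ConnesConsaniMoscovici2025, Lemma 7.2] -/
theorem prolateGuessRatio_tendsto_of_L1
    (hI0 : ∀ ε : ℝ, 0 < ε → ∃ Λ : ℝ, ∀ lam : ℝ, Λ ≤ lam → ∀ f : ℝ → ℝ,
      IsProlateFunction lam 0 f → (∫ x in (0 : ℝ)..lam, |f x - hermiteH0 x|) ≤ ε)
    (hI4 : ∀ ε : ℝ, 0 < ε → ∃ Λ : ℝ, ∀ lam : ℝ, Λ ≤ lam → ∀ f : ℝ → ℝ,
      IsProlateFunction lam 4 f → (∫ x in (0 : ℝ)..lam, |f x - hermiteH4 x|) ≤ ε)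
    (η : ℝ) (hη : 0 < η) :
    ∃ Λ : ℝ, ∀ lam : ℝ, Λ ≤ lam → ∀ f0 f4 : ℝ → ℝ, IsProlateFunction lam 0 f0 →
      IsProlateFunction lam 4 f4 → |prolateGuessRatio lam f0 f4 - hermiteRho| ≤ η := by
  set J0 := ∫ x in Ioi (0 : ℝ), hermiteH0 x with hJ0def
  have hJ0 : 0 < J0 := integral_hermiteH0_Ioi_pos
  have hJ4 : ∫ x in Ioi (0 : ℝ), hermiteH4 x = hermiteRho * J0 := integral_hermiteH4_Ioi
  set ρ := hermiteRho with hρdef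
  have hρ1 : 0 < 1 + |ρ| := by positivity
  -- the small parameter
  set e : ℝ := min (J0 / 4) (η * J0 / (4 * (1 + |ρ|))) with he_def
  have he : 0 < e := lt_min (by positivity) (by positivity)
  have he1 : e ≤ J0 / 4 := min_le_left _ _
  have he2 : e ≤ η * J0 / (4 * (1 + |ρ|)) := min_le_right _ _
  -- eventualities
  have T0 : ∀ᶠ lam : ℝ in atTop, |(∫ x in (0 : ℝ)..lam, hermiteH0 x) - J0| < e := by
    have h := intervalIntegral_tendsto_integral_Ioi 0 integrable_hermiteH0.integrableOn tendsto_id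
    have := Metric.tendsto_nhds.1 h e he
    simpa only [Real.dist_eq, id] using this
  have T4 : ∀ᶠ lam : ℝ in atTop, |(∫ x in (0 : ℝ)..lam, hermiteH4 x) - ρ * J0| < e := by
    have h := intervalIntegral_tendsto_integral_Ioi 0 integrable_hermiteH4.integrableOn tendsto_id
    rw [hJ4] at h
    have := Metric.tendsto_nhds.1 h e he
    simpa only [Real.dist_eq, id] using this
  obtain ⟨Λ0, hΛ0⟩ := hI0 e he
  obtain ⟨Λ4, hΛ4⟩ := hI4 e he
  obtain ⟨Λ, hΛ⟩ := eventually_atTop.1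
    (T0.and (T4.and ((eventually_atTop.2 ⟨Λ0, hΛ0⟩).and (eventually_atTop.2 ⟨Λ4, hΛ4⟩))))
  refine ⟨Λ, fun lam hlam f0 f4 h0 h4 ↦ ?_⟩
  obtain ⟨t0, t4, s0, s4⟩ := hΛ lam hlam
  have a0 := abs_integral_sub_two_mul_integral_le_of_L1 h0 continuous_hermiteH0 (s0 f0 h0)
  have a4 := abs_integral_sub_two_mul_integral_le_of_L1 h4 continuous_hermiteH4 (s4 f4 h4)
  unfold prolateGuessRatio
  set I0 := ∫ x in (-lam)..lam, f0 x with hI0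
  set I4 := ∫ x in (-lam)..lam, f4 x with hI4
  set T0' := ∫ x in (0 : ℝ)..lam, hermiteH0 x with hT0'
  set T4' := ∫ x in (0 : ℝ)..lam, hermiteH4 x with hT4'
  have b0 : |I0 - 2 * J0| ≤ 4 * e := by
    calc |I0 - 2 * J0| = |(I0 - 2 * T0') + 2 * (T0' - J0)| := by ring_nf
      _ ≤ |I0 - 2 * T0'| + |2 * (T0' - J0)| := abs_add_le _ _
      _ ≤ 2 * e + 2 * e := by rw [abs_mul, abs_two]; linarith [t0.le]
      _ = 4 * e := by ring
  have b4 : |I4 - 2 * (ρ * J0)| ≤ 4 * e := by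
    calc |I4 - 2 * (ρ * J0)| = |(I4 - 2 * T4') + 2 * (T4' - ρ * J0)| := by ring_nf
      _ ≤ |I4 - 2 * T4'| + |2 * (T4' - ρ * J0)| := abs_add_le _ _
      _ ≤ 2 * e + 2 * e := by rw [abs_mul, abs_two]; linarith [t4.le]
      _ = 4 * e := by ring
  have hI0pos : J0 ≤ I0 := by
    have := (abs_sub_le_iff.1 b0).2
    linarith
  have hI0ne : I0 ≠ 0 := by linarith
  have hnum : |I4 - ρ * I0| ≤ η * J0 := by
    have h4e : 4 * e * (1 + |ρ|) ≤ η * J0 := by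
      have := (le_div_iff₀ (by positivity : (0 : ℝ) < 4 * (1 + |ρ|))).1 he2
      linarith
    calc |I4 - ρ * I0| = |(I4 - 2 * (ρ * J0)) - ρ * (I0 - 2 * J0)| := by ring_nf
      _ ≤ |I4 - 2 * (ρ * J0)| + |ρ * (I0 - 2 * J0)| := abs_sub _ _
      _ ≤ 4 * e + |ρ| * (4 * e) := by
          rw [abs_mul]
          exact add_le_add b4 (mul_le_mul_of_nonneg_left b0 (abs_nonneg _))
      _ = 4 * e * (1 + |ρ|) := by ring
      _ ≤ η * J0 := h4e
  have hq : I4 / I0 - ρ = (I4 - ρ * I0) / I0 := by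
    rw [eq_div_iff hI0ne, sub_mul, div_mul_cancel₀ _ hI0ne]
  rw [hq, abs_div, div_le_iff₀ (abs_pos.2 hI0ne), abs_of_pos (by linarith : (0 : ℝ) < I0)]
  exact hnum.trans (mul_le_mul_of_nonneg_left hI0pos hη.le)

/-- **Connes' Fact 6.4 from `L¹`-type prolate → Hermite asymptotics.**  Hypotheses: the endpoint
decay `λ|h_{n,λ}(λ)| → 0` (`hE0`, `hE4`), the `L¹` convergence `∫_0^λ|h_{n,λ} − h_n| → 0` (`hI0`,
`hI4`) and the weighted `W^{1,1}` convergence `∫_0^λ|h_{n,λ}′ − h_n′|(1+x) → 0` (`hW0`, `hW4`),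
uniformly over the prolate functions, `n = 0, 4` — all of them *proved* in
`ConnesProlateGuessWindow` + `ConnesProlateGuessSturm`.  Conclusion: `prolateGuess_tendsto_riemannXi`.
[cite: ConnesConsaniMoscovici2025, Lemma 7.2, Lemma 7.3; Connes2026Letter, §6.4 Fact 6.4] -/
theorem prolateGuess_tendsto_riemannXi_of_L1Limit
    (hE0 : ∀ ε : ℝ, 0 < ε → ∃ Λ : ℝ, ∀ lam : ℝ, Λ ≤ lam → ∀ f : ℝ → ℝ,
      IsProlateFunction lam 0 f → lam * |f lam| ≤ ε)
    (hE4 : ∀ ε : ℝ, 0 < ε → ∃ Λ : ℝ, ∀ lam : ℝ, Λ ≤ lam → ∀ f : ℝ → ℝ,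
      IsProlateFunction lam 4 f → lam * |f lam| ≤ ε)
    (hI0 : ∀ ε : ℝ, 0 < ε → ∃ Λ : ℝ, ∀ lam : ℝ, Λ ≤ lam → ∀ f : ℝ → ℝ,
      IsProlateFunction lam 0 f → (∫ x in (0 : ℝ)..lam, |f x - hermiteH0 x|) ≤ ε)
    (hI4 : ∀ ε : ℝ, 0 < ε → ∃ Λ : ℝ, ∀ lam : ℝ, Λ ≤ lam → ∀ f : ℝ → ℝ,
      IsProlateFunction lam 4 f → (∫ x in (0 : ℝ)..lam, |f x - hermiteH4 x|) ≤ ε)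
    (hW0 : ∀ ε : ℝ, 0 < ε → ∃ Λ : ℝ, ∀ lam : ℝ, Λ ≤ lam → ∀ f : ℝ → ℝ,
      IsProlateFunction lam 0 f →
        (∫ x in (0 : ℝ)..lam, |deriv f x - hermiteH0' x| * (1 + x)) ≤ ε)
    (hW4 : ∀ ε : ℝ, 0 < ε → ∃ Λ : ℝ, ∀ lam : ℝ, Λ ≤ lam → ∀ f : ℝ → ℝ,
      IsProlateFunction lam 4 f →
        (∫ x in (0 : ℝ)..lam, |deriv f x - hermiteH4' x| * (1 + x)) ≤ ε) :
    prolateGuess_tendsto_riemannXi := by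
  have hA := prolateGuessA_pos
  set A := prolateGuessA with hAdef
  set ρ := hermiteRho with hρdef
  have hρ1 : 1 ≤ |ρ| + 1 := by linarith [abs_nonneg ρ]
  have hR := prolateGuessRatio_tendsto_of_L1 hI0 hI4
  -- eventual bound `|ρ_λ| ≤ |ρ| + 1`
  have Eρ : ∀ᶠ lam : ℝ in atTop, ∀ f0 f4 : ℝ → ℝ, IsProlateFunction lam 0 f0 →
      IsProlateFunction lam 4 f4 → |prolateGuessRatio lam f0 f4| ≤ |ρ| + 1 := by
    obtain ⟨Λ, hΛ⟩ := hR 1 one_pos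
    refine eventually_atTop.2 ⟨Λ, fun lam hlam f0 f4 h0 h4 ↦ ?_⟩
    have h := hΛ lam hlam f0 f4 h0 h4
    calc |prolateGuessRatio lam f0 f4| = |(prolateGuessRatio lam f0 f4 - ρ) + ρ| := by ring_nf
      _ ≤ |prolateGuessRatio lam f0 f4 - ρ| + |ρ| := abs_add_le _ _
      _ ≤ |ρ| + 1 := by linarith
  refine prolateGuess_tendsto_riemannXi_of_deriv_tendsto ?_ ?_
  · -- (E): endpoint decay
    intro ε hε
    set e : ℝ := ε / (4 * A * (|ρ| + 1)) with he_def
    have he : 0 < e := by positivity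
    have E4 : ∀ᶠ lam : ℝ in atTop, ∀ f : ℝ → ℝ, IsProlateFunction lam 4 f →
        lam * |f lam| ≤ 2 * e := by
      obtain ⟨Λ, hΛ⟩ := hE4 (2 * e) (by positivity); exact eventually_atTop.2 ⟨Λ, hΛ⟩
    have E0 : ∀ᶠ lam : ℝ in atTop, ∀ f : ℝ → ℝ, IsProlateFunction lam 0 f →
        lam * |f lam| ≤ 2 * e := by
      obtain ⟨Λ, hΛ⟩ := hE0 (2 * e) (by positivity); exact eventually_atTop.2 ⟨Λ, hΛ⟩
    obtain ⟨Λ, hΛ⟩ := eventually_atTop.1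
      ((eventually_gt_atTop 0).and (E4.and (E0.and Eρ)))
    refine ⟨Λ, fun lam hlam f0 f4 h0 h4 ↦ ?_⟩
    obtain ⟨hlam0, s4, s0, r⟩ := hΛ lam hlam
    have u4 : lam * |f4 lam| ≤ 2 * e := s4 f4 h4
    have u0 : lam * |f0 lam| ≤ 2 * e := s0 f0 h0
    have hr := r f0 f4 h0 h4
    rw [prolateGuessH_eq, abs_mul, abs_of_pos hA]
    have step : |f4 lam - prolateGuessRatio lam f0 f4 * f0 lam| * lam
        ≤ 2 * e + (|ρ| + 1) * (2 * e) := by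
      have h1 : |f4 lam - prolateGuessRatio lam f0 f4 * f0 lam|
          ≤ |f4 lam| + |prolateGuessRatio lam f0 f4| * |f0 lam| := by
        calc _ ≤ |f4 lam| + |prolateGuessRatio lam f0 f4 * f0 lam| := abs_sub _ _
          _ = _ := by rw [abs_mul]
      have h2 : |prolateGuessRatio lam f0 f4| * (lam * |f0 lam|) ≤ (|ρ| + 1) * (2 * e) :=
        mul_le_mul hr u0 (by positivity) (by positivity)
      nlinarith [abs_nonneg (f4 lam), abs_nonneg (f0 lam), abs_nonneg (prolateGuessRatio lam f0 f4)]
    calc A * |f4 lam - prolateGuessRatio lam f0 f4 * f0 lam| * lam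
        = A * (|f4 lam - prolateGuessRatio lam f0 f4 * f0 lam| * lam) := by ring
      _ ≤ A * (2 * e + (|ρ| + 1) * (2 * e)) := mul_le_mul_of_nonneg_left step hA.le
      _ ≤ A * ((|ρ| + 1) * (2 * e) + (|ρ| + 1) * (2 * e)) := by
          apply mul_le_mul_of_nonneg_left _ hA.le
          nlinarith
      _ = ε := by
          rw [he_def]; field_simp; ring
  · -- (W): weighted W¹¹ convergence
    intro ε hε
    set C1 := ∫ x in Ioi (0 : ℝ), |hermiteH0' x| * (1 + x) with hC1def
    have hC1 : 0 ≤ C1 :=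
      setIntegral_nonneg measurableSet_Ioi fun x hx ↦ mul_nonneg (abs_nonneg _) (by
        have : (0 : ℝ) < x := hx
        linarith)
    set e4 : ℝ := ε / (3 * A) with he4_def
    set e0 : ℝ := ε / (3 * A * (|ρ| + 1)) with he0_def
    set η : ℝ := ε / (3 * A * (C1 + 1)) with hη_def
    have he4 : 0 < e4 := by positivity
    have he0 : 0 < e0 := by positivity
    have hη : 0 < η := by positivity
    have E4 : ∀ᶠ lam : ℝ in atTop, ∀ f : ℝ → ℝ, IsProlateFunction lam 4 f →
        (∫ x in (0 : ℝ)..lam, |deriv f x - hermiteH4' x| * (1 + x)) ≤ e4 := by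
      obtain ⟨Λ, hΛ⟩ := hW4 e4 he4; exact eventually_atTop.2 ⟨Λ, hΛ⟩
    have E0 : ∀ᶠ lam : ℝ in atTop, ∀ f : ℝ → ℝ, IsProlateFunction lam 0 f →
        (∫ x in (0 : ℝ)..lam, |deriv f x - hermiteH0' x| * (1 + x)) ≤ e0 := by
      obtain ⟨Λ, hΛ⟩ := hW0 e0 he0; exact eventually_atTop.2 ⟨Λ, hΛ⟩
    have Eη : ∀ᶠ lam : ℝ in atTop, ∀ f0 f4 : ℝ → ℝ, IsProlateFunction lam 0 f0 →
        IsProlateFunction lam 4 f4 → |prolateGuessRatio lam f0 f4 - ρ| ≤ η := by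
      obtain ⟨Λ, hΛ⟩ := hR η hη; exact eventually_atTop.2 ⟨Λ, hΛ⟩
    obtain ⟨Λ, hΛ⟩ := eventually_atTop.1
      ((eventually_gt_atTop 0).and (E4.and (E0.and (Eη.and Eρ))))
    refine ⟨Λ, fun lam hlam f0 f4 h0 h4 ↦ ?_⟩
    obtain ⟨hlam0, w4, w0, rη, r⟩ := hΛ lam hlam
    have hw4 := w4 f4 h4
    have hw0 := w0 f0 h0
    have hr := r f0 f4 h0 h4
    have hrη := rη f0 f4 h0 h4
    set R := prolateGuessRatio lam f0 f4 with hRdef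
    -- integrability on `[0, λ]`
    obtain ⟨-, hdi⟩ := prolateGuessH_hasDerivAt h0 h4
    have iL : IntervalIntegrable
        (fun x ↦ |deriv (prolateGuessH lam f0 f4) x - connesHermiteH' x| * (1 + x)) volume 0 lam :=
      (hdi.sub (continuous_connesHermiteH'.intervalIntegrable _ _)).abs.mul_continuousOn
        (by fun_prop)
    have i4 : IntervalIntegrable (fun x ↦ |deriv f4 x - hermiteH4' x| * (1 + x)) volume 0 lam :=
      (h4.intervalIntegrable_deriv.sub (continuous_hermiteH4'.intervalIntegrable _ _)).abs
        |>.mul_continuousOn (by fun_prop)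
    have i0 : IntervalIntegrable (fun x ↦ |deriv f0 x - hermiteH0' x| * (1 + x)) volume 0 lam :=
      (h0.intervalIntegrable_deriv.sub (continuous_hermiteH0'.intervalIntegrable _ _)).abs
        |>.mul_continuousOn (by fun_prop)
    have ik : IntervalIntegrable (fun x ↦ |hermiteH0' x| * (1 + x)) volume 0 lam :=
      (continuous_hermiteH0'.abs.mul (continuous_const.add continuous_id)).intervalIntegrable _ _
    -- pointwise identity and bound on `(0, λ)`
    have hpt : ∀ x ∈ Ioo 0 lam,
        |deriv (prolateGuessH lam f0 f4) x - connesHermiteH' x| * (1 + x)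
          ≤ A * (|deriv f4 x - hermiteH4' x| * (1 + x) + |R| * (|deriv f0 x - hermiteH0' x| * (1 + x))
              + |R - ρ| * (|hermiteH0' x| * (1 + x))) := by
      intro x hx
      have hx' : x ∈ Ioo (-lam) lam := ⟨by linarith [hx.1], hx.2⟩
      have hx1 : 0 ≤ 1 + x := by linarith [hx.1]
      rw [deriv_prolateGuessH h0 h4 hx', ← prolateGuessA_mul_hermite_sub' x]
      have e : A * (deriv f4 x - R * deriv f0 x) - A * (hermiteH4' x - ρ * hermiteH0' x)
          = A * ((deriv f4 x - hermiteH4' x) - R * (deriv f0 x - hermiteH0' x)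
              - (R - ρ) * hermiteH0' x) := by ring
      rw [e, abs_mul, abs_of_pos hA, mul_assoc]
      refine mul_le_mul_of_nonneg_left ?_ hA.le
      have t : |(deriv f4 x - hermiteH4' x) - R * (deriv f0 x - hermiteH0' x) - (R - ρ) * hermiteH0' x|
          ≤ |deriv f4 x - hermiteH4' x| + |R| * |deriv f0 x - hermiteH0' x|
              + |R - ρ| * |hermiteH0' x| := by
        calc _ ≤ |(deriv f4 x - hermiteH4' x) - R * (deriv f0 x - hermiteH0' x)|
              + |(R - ρ) * hermiteH0' x| := abs_sub _ _
          _ ≤ |deriv f4 x - hermiteH4' x| + |R * (deriv f0 x - hermiteH0' x)|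
              + |(R - ρ) * hermiteH0' x| := by gcongr; exact abs_sub _ _
          _ = _ := by rw [abs_mul, abs_mul]
      have := mul_le_mul_of_nonneg_right t hx1
      linarith [this]
    have hint : (∫ x in (0 : ℝ)..lam,
        |deriv (prolateGuessH lam f0 f4) x - connesHermiteH' x| * (1 + x))
          ≤ ∫ x in (0 : ℝ)..lam, A * (|deriv f4 x - hermiteH4' x| * (1 + x)
              + |R| * (|deriv f0 x - hermiteH0' x| * (1 + x)) + |R - ρ| * (|hermiteH0' x| * (1 + x))) :=
      intervalIntegral.integral_mono_on_of_le_Ioo hlam0.le iL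
        (((i4.add (i0.const_mul |R|)).add (ik.const_mul |R - ρ|)).const_mul A) hpt
    have hsplit : (∫ x in (0 : ℝ)..lam, A * (|deriv f4 x - hermiteH4' x| * (1 + x)
        + |R| * (|deriv f0 x - hermiteH0' x| * (1 + x)) + |R - ρ| * (|hermiteH0' x| * (1 + x))))
          = A * ((∫ x in (0 : ℝ)..lam, |deriv f4 x - hermiteH4' x| * (1 + x))
              + |R| * (∫ x in (0 : ℝ)..lam, |deriv f0 x - hermiteH0' x| * (1 + x))
              + |R - ρ| * (∫ x in (0 : ℝ)..lam, |hermiteH0' x| * (1 + x))) := by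
      rw [intervalIntegral.integral_const_mul, intervalIntegral.integral_add (i4.add (i0.const_mul _))
        (ik.const_mul _), intervalIntegral.integral_add i4 (i0.const_mul _),
        intervalIntegral.integral_const_mul, intervalIntegral.integral_const_mul]
    have hk : (∫ x in (0 : ℝ)..lam, |hermiteH0' x| * (1 + x)) ≤ C1 := by
      rw [intervalIntegral.integral_of_le hlam0.le]
      exact setIntegral_mono_set integrableOn_abs_hermiteH0'_mul
        ((ae_restrict_mem measurableSet_Ioi).mono fun x hx ↦
          mul_nonneg (abs_nonneg _) (by have : (0 : ℝ) < x := hx; linarith))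
        Ioc_subset_Ioi_self.eventuallyLE
    have hk0 : 0 ≤ ∫ x in (0 : ℝ)..lam, |deriv f0 x - hermiteH0' x| * (1 + x) :=
      intervalIntegral.integral_nonneg hlam0.le fun x hx ↦
        mul_nonneg (abs_nonneg _) (by linarith [hx.1])
    -- the three pieces
    have p4 : A * (∫ x in (0 : ℝ)..lam, |deriv f4 x - hermiteH4' x| * (1 + x)) ≤ ε / 3 := by
      calc _ ≤ A * e4 := mul_le_mul_of_nonneg_left hw4 hA.le
        _ = ε / 3 := by rw [he4_def]; field_simp
    have p0 : A * (|R| * (∫ x in (0 : ℝ)..lam, |deriv f0 x - hermiteH0' x| * (1 + x))) ≤ ε / 3 := by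
      calc _ ≤ A * ((|ρ| + 1) * e0) :=
            mul_le_mul_of_nonneg_left (mul_le_mul hr hw0 hk0 (by positivity)) hA.le
        _ = ε / 3 := by rw [he0_def]; field_simp
    have pk : A * (|R - ρ| * (∫ x in (0 : ℝ)..lam, |hermiteH0' x| * (1 + x))) ≤ ε / 3 := by
      calc _ ≤ A * (η * C1) :=
            mul_le_mul_of_nonneg_left (mul_le_mul hrη hk
              (intervalIntegral.integral_nonneg hlam0.le fun x hx ↦
                mul_nonneg (abs_nonneg _) (by linarith [hx.1])) hη.le) hA.le
        _ ≤ A * (η * (C1 + 1)) := by gcongr; linarith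
        _ = ε / 3 := by rw [hη_def]; field_simp
    calc _ ≤ _ := hint
      _ = _ := hsplit
      _ = A * (∫ x in (0 : ℝ)..lam, |deriv f4 x - hermiteH4' x| * (1 + x))
          + A * (|R| * (∫ x in (0 : ℝ)..lam, |deriv f0 x - hermiteH0' x| * (1 + x)))
          + A * (|R - ρ| * (∫ x in (0 : ℝ)..lam, |hermiteH0' x| * (1 + x))) := by ring
      _ ≤ ε / 3 + ε / 3 + ε / 3 := add_le_add (add_le_add p4 p0) pk
      _ = ε := by ring


/-! ### Hermite data: decay of `h_n′`, Gaussian moments, `∫_0^∞ h_n² = 1/2`, `L¹` limits -/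

/-- `h_0′ → 0` at `+∞`. [folklore] -/
theorem tendsto_hermiteH0'_atTop : Tendsto hermiteH0' atTop (𝓝 0) := by
  have h := tendsto_mul_hermiteH0_atTop.const_mul (-(2 * π))
  simp only [mul_zero] at h
  refine h.congr fun x ↦ ?_
  simp only [hermiteH0', hermiteH0]; ring

/-- `h_4′ → 0` at `+∞`. [folklore] -/
theorem tendsto_hermiteH4'_atTop : Tendsto hermiteH4' atTop (𝓝 0) := by
  have hexp : Tendsto (fun x : ℝ ↦ Real.exp (-(1 / 2) * x)) atTop (𝓝 0) :=
    Real.tendsto_exp_comp_nhds_zero.mpr (tendsto_id.const_mul_atTop_of_neg (by norm_num))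
  have h5 : Tendsto (fun x : ℝ ↦ x ^ (5 : ℝ) * Real.exp (-π * x ^ 2)) atTop (𝓝 0) :=
    (rpow_mul_exp_neg_mul_sq_isLittleO_exp_neg Real.pi_pos _).trans_tendsto hexp
  have h3 : Tendsto (fun x : ℝ ↦ x ^ (3 : ℝ) * Real.exp (-π * x ^ 2)) atTop (𝓝 0) :=
    (rpow_mul_exp_neg_mul_sq_isLittleO_exp_neg Real.pi_pos _).trans_tendsto hexp
  have h1 : Tendsto (fun x : ℝ ↦ x ^ (1 : ℝ) * Real.exp (-π * x ^ 2)) atTop (𝓝 0) :=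
    (rpow_mul_exp_neg_mul_sq_isLittleO_exp_neg Real.pi_pos _).trans_tendsto hexp
  have h := (((h5.const_mul (-32 * π ^ 3)).add (h3.const_mul (112 * π ^ 2))).sub
    (h1.const_mul (54 * π))).div_const (16 * prolateGuessA)
  simp only [mul_zero, sub_zero, add_zero, zero_div] at h
  refine h.congr' ?_
  filter_upwards [eventually_gt_atTop (0 : ℝ)] with x hx
  simp only [hermiteH4']
  rw [show (5 : ℝ) = ((5 : ℕ) : ℝ) by norm_num, show (3 : ℝ) = ((3 : ℕ) : ℝ) by norm_num,
    Real.rpow_natCast, Real.rpow_natCast, Real.rpow_one]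
  ring

/-- `(e^{−πx²})² = e^{−2πx²}`. [folklore] -/
theorem exp_neg_pi_mul_sq_sq (x : ℝ) :
    Real.exp (-π * x ^ 2) ^ 2 = Real.exp (-(2 * π) * x ^ 2) := by
  rw [← Real.exp_nat_mul]; congr 1; push_cast; ring

/-- `x ↦ x^k e^{−2πx²}` is integrable on `ℝ`. [folklore] -/
theorem integrable_pow_mul_exp_neg_two_pi_mul_sq (k : ℕ) :
    Integrable fun x : ℝ ↦ x ^ k * Real.exp (-(2 * π) * x ^ 2) := by
  have h := integrable_rpow_mul_exp_neg_mul_sq (by positivity : 0 < 2 * π) (s := k)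
    (by have := Nat.cast_nonneg (α := ℝ) k; linarith)
  refine h.congr (ae_of_all _ fun x ↦ ?_)
  simp only [Real.rpow_natCast]

/-- Gaussian moment recursion: `∫_0^∞ x^{k+2}e^{−2πx²} = (k+1)/(4π)·∫_0^∞ x^k e^{−2πx²}`
(integration by parts). [folklore] -/
theorem integral_pow_mul_exp_neg_two_pi_mul_sq_succ_succ (k : ℕ) :
    ∫ x in Ioi (0 : ℝ), x ^ (k + 2) * Real.exp (-(2 * π) * x ^ 2)
      = (k + 1) / (4 * π) * ∫ x in Ioi (0 : ℝ), x ^ k * Real.exp (-(2 * π) * x ^ 2) := by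
  have hderiv : ∀ x ∈ Ici (0 : ℝ),
      HasDerivAt (fun y : ℝ ↦ y ^ (k + 1) * Real.exp (-(2 * π) * y ^ 2))
        ((k + 1) * (x ^ k * Real.exp (-(2 * π) * x ^ 2))
          - 4 * π * (x ^ (k + 2) * Real.exp (-(2 * π) * x ^ 2))) x := by
    intro x _
    have a := (hasDerivAt_pow (k + 1) x).mul (((hasDerivAt_pow 2 x).const_mul (-(2 * π))).exp)
    refine a.congr_deriv ?_
    simp only [Nat.add_sub_cancel, Nat.cast_add, Nat.cast_one]
    ring
  have hint : IntegrableOn (fun x : ℝ ↦ (k + 1) * (x ^ k * Real.exp (-(2 * π) * x ^ 2))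
      - 4 * π * (x ^ (k + 2) * Real.exp (-(2 * π) * x ^ 2))) (Ioi 0) :=
    (((integrable_pow_mul_exp_neg_two_pi_mul_sq k).const_mul _).sub
      ((integrable_pow_mul_exp_neg_two_pi_mul_sq (k + 2)).const_mul _)).integrableOn
  have hlim : Tendsto (fun y : ℝ ↦ y ^ (k + 1) * Real.exp (-(2 * π) * y ^ 2)) atTop (𝓝 0) := by
    have hexp : Tendsto (fun x : ℝ ↦ Real.exp (-(1 / 2) * x)) atTop (𝓝 0) :=
      Real.tendsto_exp_comp_nhds_zero.mpr (tendsto_id.const_mul_atTop_of_neg (by norm_num))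
    have h := (rpow_mul_exp_neg_mul_sq_isLittleO_exp_neg (by positivity : 0 < 2 * π)
      ((k + 1 : ℕ) : ℝ)).trans_tendsto hexp
    refine h.congr' ?_
    filter_upwards [eventually_gt_atTop (0 : ℝ)] with x hx
    rw [Real.rpow_natCast]
  have h := integral_Ioi_of_hasDerivAt_of_tendsto' hderiv hint hlim
  have h0 : (0 : ℝ) ^ (k + 1) * Real.exp (-(2 * π) * (0 : ℝ) ^ 2) = 0 := by simp
  rw [h0, sub_zero, MeasureTheory.integral_sub
    (((integrable_pow_mul_exp_neg_two_pi_mul_sq k).const_mul _).integrableOn)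
    (((integrable_pow_mul_exp_neg_two_pi_mul_sq (k + 2)).const_mul _).integrableOn),
    MeasureTheory.integral_const_mul, MeasureTheory.integral_const_mul] at h
  have hπ : 0 < 4 * π := by positivity
  rw [div_mul_eq_mul_div, eq_div_iff hπ.ne']
  linarith

/-- `∫_0^∞ e^{−2πx²}dx = √2/4`. [folklore] -/
theorem integral_exp_neg_two_pi_mul_sq_Ioi :
    ∫ x in Ioi (0 : ℝ), x ^ 0 * Real.exp (-(2 * π) * x ^ 2) = Real.sqrt 2 / 4 := by
  simp only [pow_zero, one_mul]
  rw [integral_gaussian_Ioi (2 * π)]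
  have hπ := Real.pi_pos.ne'
  rw [show π / (2 * π) = 2 / 4 by field_simp; ring, Real.sqrt_div (by norm_num : (0 : ℝ) ≤ 2),
    show (4 : ℝ) = 2 ^ 2 by norm_num, Real.sqrt_sq (by norm_num : (0 : ℝ) ≤ 2)]
  ring

/-- `∫_0^∞ h_0² = 1/2` (`‖h_0‖_{L²(ℝ)} = 1`). [cite: ConnesConsaniMoscovici2025, Lemma 7.2] -/
theorem integral_sq_hermiteH0_Ioi : ∫ x in Ioi (0 : ℝ), hermiteH0 x ^ 2 = 1 / 2 := by
  have h2 : ((2 : ℝ) ^ ((1 : ℝ) / 4)) ^ 2 = Real.sqrt 2 := by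
    rw [← Real.rpow_natCast, ← Real.rpow_mul (by norm_num : (0 : ℝ) ≤ 2), Real.sqrt_eq_rpow]
    norm_num
  have e : ∀ x, hermiteH0 x ^ 2 = Real.sqrt 2 * (x ^ 0 * Real.exp (-(2 * π) * x ^ 2)) := by
    intro x
    simp only [hermiteH0]
    rw [mul_pow, h2, exp_neg_pi_mul_sq_sq, pow_zero, one_mul]
  simp_rw [e]
  rw [MeasureTheory.integral_const_mul, integral_exp_neg_two_pi_mul_sq_Ioi]
  have s2 : Real.sqrt 2 * Real.sqrt 2 = 2 := Real.mul_self_sqrt (by norm_num)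
  linear_combination (1 / 4 : ℝ) * s2

/-- `A² = 3/(32√2)`. [folklore] -/
theorem prolateGuessA_sq : prolateGuessA ^ 2 = 3 / (32 * Real.sqrt 2) := by
  unfold prolateGuessA
  rw [div_pow, Real.sq_sqrt (by norm_num : (0 : ℝ) ≤ 3)]
  congr 1
  rw [← Real.rpow_natCast, ← Real.rpow_mul (by norm_num : (0 : ℝ) ≤ 2), Real.sqrt_eq_rpow,
    show (11 : ℝ) / 4 * ((2 : ℕ) : ℝ) = ((5 : ℕ) : ℝ) + 1 / 2 by norm_num,
    Real.rpow_add (by norm_num : (0 : ℝ) < 2), Real.rpow_natCast]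
  norm_num

/-- `∫_0^∞ h_4² = 1/2` (`‖h_4‖_{L²(ℝ)} = 1`), by the Gaussian moments
`∫_0^∞ x^{2j}e^{−2πx²} = (2j−1)!!/(4π)^j·√2/4`. [cite: ConnesConsaniMoscovici2025, Lemma 7.2] -/
theorem integral_sq_hermiteH4_Ioi : ∫ x in Ioi (0 : ℝ), hermiteH4 x ^ 2 = 1 / 2 := by
  have hA := prolateGuessA_pos
  have hπ := Real.pi_pos
  have M := integral_pow_mul_exp_neg_two_pi_mul_sq_succ_succ
  have I := fun k ↦ (integrable_pow_mul_exp_neg_two_pi_mul_sq k).integrableOn (s := Ioi (0 : ℝ))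
  have I0eq := integral_exp_neg_two_pi_mul_sq_Ioi
  have I2eq : ∫ x in Ioi (0 : ℝ), x ^ 2 * Real.exp (-(2 * π) * x ^ 2)
      = (((0 : ℕ) : ℝ) + 1) / (4 * π) * ∫ x in Ioi (0 : ℝ), x ^ 0 * Real.exp (-(2 * π) * x ^ 2) :=
    M 0
  have I4eq : ∫ x in Ioi (0 : ℝ), x ^ 4 * Real.exp (-(2 * π) * x ^ 2)
      = (((2 : ℕ) : ℝ) + 1) / (4 * π) * ∫ x in Ioi (0 : ℝ), x ^ 2 * Real.exp (-(2 * π) * x ^ 2) :=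
    M 2
  have I6eq : ∫ x in Ioi (0 : ℝ), x ^ 6 * Real.exp (-(2 * π) * x ^ 2)
      = (((4 : ℕ) : ℝ) + 1) / (4 * π) * ∫ x in Ioi (0 : ℝ), x ^ 4 * Real.exp (-(2 * π) * x ^ 2) :=
    M 4
  have I8eq : ∫ x in Ioi (0 : ℝ), x ^ 8 * Real.exp (-(2 * π) * x ^ 2)
      = (((6 : ℕ) : ℝ) + 1) / (4 * π) * ∫ x in Ioi (0 : ℝ), x ^ 6 * Real.exp (-(2 * π) * x ^ 2) :=
    M 6
  have e : ∀ x, hermiteH4 x ^ 2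
      = (256 * π ^ 4 * (x ^ 8 * Real.exp (-(2 * π) * x ^ 2))
          - 768 * π ^ 3 * (x ^ 6 * Real.exp (-(2 * π) * x ^ 2))
          + 672 * π ^ 2 * (x ^ 4 * Real.exp (-(2 * π) * x ^ 2))
          - 144 * π * (x ^ 2 * Real.exp (-(2 * π) * x ^ 2))
          + 9 * (x ^ 0 * Real.exp (-(2 * π) * x ^ 2))) / (256 * prolateGuessA ^ 2) := by
    intro x
    simp only [hermiteH4]
    rw [div_pow, mul_pow, exp_neg_pi_mul_sq_sq]
    field_simp
    ring
  simp_rw [e]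
  rw [MeasureTheory.integral_div]
  have c8 : Integrable (fun x : ℝ ↦ 256 * π ^ 4 * (x ^ 8 * Real.exp (-(2 * π) * x ^ 2))) (volume.restrict (Ioi 0)) := (I 8).const_mul _
  have c6 : Integrable (fun x : ℝ ↦ 768 * π ^ 3 * (x ^ 6 * Real.exp (-(2 * π) * x ^ 2))) (volume.restrict (Ioi 0)) := (I 6).const_mul _
  have c4 : Integrable (fun x : ℝ ↦ 672 * π ^ 2 * (x ^ 4 * Real.exp (-(2 * π) * x ^ 2))) (volume.restrict (Ioi 0)) := (I 4).const_mul _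
  have c2 : Integrable (fun x : ℝ ↦ 144 * π * (x ^ 2 * Real.exp (-(2 * π) * x ^ 2))) (volume.restrict (Ioi 0)) := (I 2).const_mul _
  have c0 : Integrable (fun x : ℝ ↦ 9 * (x ^ 0 * Real.exp (-(2 * π) * x ^ 2))) (volume.restrict (Ioi 0)) := (I 0).const_mul _
  have A1 : (∫ x in Ioi (0 : ℝ), 256 * π ^ 4 * (x ^ 8 * Real.exp (-(2 * π) * x ^ 2)) - 768 * π ^ 3 * (x ^ 6 * Real.exp (-(2 * π) * x ^ 2))) = (∫ x in Ioi (0 : ℝ), 256 * π ^ 4 * (x ^ 8 * Real.exp (-(2 * π) * x ^ 2))) - (∫ x in Ioi (0 : ℝ), 768 * π ^ 3 * (x ^ 6 * Real.exp (-(2 * π) * x ^ 2))) :=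
    MeasureTheory.integral_sub c8 c6
  have A2 : (∫ x in Ioi (0 : ℝ), 256 * π ^ 4 * (x ^ 8 * Real.exp (-(2 * π) * x ^ 2)) - 768 * π ^ 3 * (x ^ 6 * Real.exp (-(2 * π) * x ^ 2)) + 672 * π ^ 2 * (x ^ 4 * Real.exp (-(2 * π) * x ^ 2)))
      = (∫ x in Ioi (0 : ℝ), 256 * π ^ 4 * (x ^ 8 * Real.exp (-(2 * π) * x ^ 2)) - 768 * π ^ 3 * (x ^ 6 * Real.exp (-(2 * π) * x ^ 2))) + (∫ x in Ioi (0 : ℝ), 672 * π ^ 2 * (x ^ 4 * Real.exp (-(2 * π) * x ^ 2))) :=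
    MeasureTheory.integral_add (c8.sub c6) c4
  have A3 : (∫ x in Ioi (0 : ℝ), 256 * π ^ 4 * (x ^ 8 * Real.exp (-(2 * π) * x ^ 2)) - 768 * π ^ 3 * (x ^ 6 * Real.exp (-(2 * π) * x ^ 2)) + 672 * π ^ 2 * (x ^ 4 * Real.exp (-(2 * π) * x ^ 2)) - 144 * π * (x ^ 2 * Real.exp (-(2 * π) * x ^ 2)))
      = (∫ x in Ioi (0 : ℝ), 256 * π ^ 4 * (x ^ 8 * Real.exp (-(2 * π) * x ^ 2)) - 768 * π ^ 3 * (x ^ 6 * Real.exp (-(2 * π) * x ^ 2)) + 672 * π ^ 2 * (x ^ 4 * Real.exp (-(2 * π) * x ^ 2)))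
        - (∫ x in Ioi (0 : ℝ), 144 * π * (x ^ 2 * Real.exp (-(2 * π) * x ^ 2))) :=
    MeasureTheory.integral_sub ((c8.sub c6).add c4) c2
  have A4 : (∫ x in Ioi (0 : ℝ), 256 * π ^ 4 * (x ^ 8 * Real.exp (-(2 * π) * x ^ 2)) - 768 * π ^ 3 * (x ^ 6 * Real.exp (-(2 * π) * x ^ 2)) + 672 * π ^ 2 * (x ^ 4 * Real.exp (-(2 * π) * x ^ 2)) - 144 * π * (x ^ 2 * Real.exp (-(2 * π) * x ^ 2)) + 9 * (x ^ 0 * Real.exp (-(2 * π) * x ^ 2)))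
      = (∫ x in Ioi (0 : ℝ), 256 * π ^ 4 * (x ^ 8 * Real.exp (-(2 * π) * x ^ 2)) - 768 * π ^ 3 * (x ^ 6 * Real.exp (-(2 * π) * x ^ 2)) + 672 * π ^ 2 * (x ^ 4 * Real.exp (-(2 * π) * x ^ 2)) - 144 * π * (x ^ 2 * Real.exp (-(2 * π) * x ^ 2)))
        + (∫ x in Ioi (0 : ℝ), 9 * (x ^ 0 * Real.exp (-(2 * π) * x ^ 2))) :=
    MeasureTheory.integral_add (((c8.sub c6).add c4).sub c2) c0
  rw [A4, A3, A2, A1, MeasureTheory.integral_const_mul, MeasureTheory.integral_const_mul,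
    MeasureTheory.integral_const_mul, MeasureTheory.integral_const_mul,
    MeasureTheory.integral_const_mul]
  rw [I8eq, I6eq, I4eq, I2eq, I0eq, prolateGuessA_sq]
  have s2 : Real.sqrt 2 * Real.sqrt 2 = 2 := Real.mul_self_sqrt (by norm_num)
  have s0 : 0 < Real.sqrt 2 := Real.sqrt_pos.2 (by norm_num)
  push_cast
  field_simp
  linarith [s2]

/-- `∫_0^X h_0² → 1/2`. [folklore] -/
theorem tendsto_integral_sq_hermiteH0 :
    Tendsto (fun X : ℝ ↦ ∫ x in (0 : ℝ)..X, hermiteH0 x ^ 2) atTop (𝓝 (1 / 2)) := by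
  have h := intervalIntegral_tendsto_integral_Ioi 0
    (integrable_sq_of_abs_le continuous_hermiteH0 abs_hermiteH0_le integrable_hermiteH0).integrableOn
    tendsto_id
  rw [integral_sq_hermiteH0_Ioi] at h
  exact h

/-- `∫_0^X h_4² → 1/2`. [folklore] -/
theorem tendsto_integral_sq_hermiteH4 :
    Tendsto (fun X : ℝ ↦ ∫ x in (0 : ℝ)..X, hermiteH4 x ^ 2) atTop (𝓝 (1 / 2)) := by
  have h := intervalIntegral_tendsto_integral_Ioi 0
    (integrable_sq_of_abs_le continuous_hermiteH4 abs_hermiteH4_le integrable_hermiteH4).integrableOn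
    tendsto_id
  rw [integral_sq_hermiteH4_Ioi] at h
  exact h

/-- `∫_0^X |h_0| → ∫_0^∞ |h_0|`. [folklore] -/
theorem tendsto_integral_abs_hermiteH0 :
    Tendsto (fun X : ℝ ↦ ∫ x in (0 : ℝ)..X, |hermiteH0 x|) atTop
      (𝓝 (∫ x in Ioi (0 : ℝ), |hermiteH0 x|)) :=
  intervalIntegral_tendsto_integral_Ioi 0 integrable_hermiteH0.abs.integrableOn tendsto_id

/-- `∫_0^X |h_4| → ∫_0^∞ |h_4|`. [folklore] -/
theorem tendsto_integral_abs_hermiteH4 :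
    Tendsto (fun X : ℝ ↦ ∫ x in (0 : ℝ)..X, |hermiteH4 x|) atTop
      (𝓝 (∫ x in Ioi (0 : ℝ), |hermiteH4 x|)) :=
  intervalIntegral_tendsto_integral_Ioi 0 integrable_hermiteH4.abs.integrableOn tendsto_id

/-- `∫_0^X |h_0′|(1+x) → ∫_0^∞ |h_0′|(1+x)`. [folklore] -/
theorem tendsto_integral_abs_hermiteH0'_mul :
    Tendsto (fun X : ℝ ↦ ∫ x in (0 : ℝ)..X, |hermiteH0' x| * (1 + x)) atTop
      (𝓝 (∫ x in Ioi (0 : ℝ), |hermiteH0' x| * (1 + x))) :=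
  intervalIntegral_tendsto_integral_Ioi 0 integrableOn_abs_hermiteH0'_mul tendsto_id

/-- `∫_0^X |h_4′|(1+x) → ∫_0^∞ |h_4′|(1+x)`. [folklore] -/
theorem tendsto_integral_abs_hermiteH4'_mul :
    Tendsto (fun X : ℝ ↦ ∫ x in (0 : ℝ)..X, |hermiteH4' x| * (1 + x)) atTop
      (𝓝 (∫ x in Ioi (0 : ℝ), |hermiteH4' x| * (1 + x))) :=
  intervalIntegral_tendsto_integral_Ioi 0 integrableOn_abs_hermiteH4'_mul tendsto_id


/-! ### The uniform prolate → Hermite limits for `n = 0, 4`, and Fact 6.4 RH-free -/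

/-- **Uniform prolate → Hermite limits, `n = 0`**: `λ|h_{0,λ}(λ)| → 0`, `∫_0^λ|h_{0,λ} − h_0| → 0`,
`∫_0^λ|h_{0,λ}′ − h_0′|(1+x) → 0`, uniformly over the prolate functions with no zeros — from the
interface `IsProlateFunction` alone (eigenvalue pinning `ConnesProlateGuessSturm` + window/tail
estimates `ConnesProlateGuessWindow`). [cite: ConnesConsaniMoscovici2025, Lemma 7.2; SlepianPollak1961, §III] -/
theorem IsProlateFunction.uniform_limits_zero :
    ∀ ε : ℝ, 0 < ε → ∃ Λ : ℝ, ∀ lam : ℝ, Λ ≤ lam → ∀ f : ℝ → ℝ, IsProlateFunction lam 0 f →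
      lam * |f lam| ≤ ε ∧ (∫ x in (0 : ℝ)..lam, |f x - hermiteH0 x|) ≤ ε ∧
      (∫ x in (0 : ℝ)..lam, |deriv f x - hermiteH0' x| * (1 + x)) ≤ ε :=
  IsProlateFunction.uniform_limits (n := 0) (μ := 2 * π) (by linarith [Real.pi_gt_three])
    (fun _ hδ ↦ IsProlateFunction.eigen_tendsto_of_zero hδ) hasDerivAt_hermiteH0
    hasDerivAt_hermiteH0' (hermiteH0_pos 0) hermiteH0'_zero abs_hermiteH0_le
    tendsto_mul_hermiteH0_atTop tendsto_hermiteH0'_atTop tendsto_integral_sq_hermiteH0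
    tendsto_integral_abs_hermiteH0 tendsto_integral_abs_hermiteH0'_mul

/-- **Uniform prolate → Hermite limits, `n = 4`**: `λ|h_{4,λ}(λ)| → 0`, `∫_0^λ|h_{4,λ} − h_4| → 0`,
`∫_0^λ|h_{4,λ}′ − h_4′|(1+x) → 0`, uniformly over the prolate functions with four zeros.
[cite: ConnesConsaniMoscovici2025, Lemma 7.2; SlepianPollak1961, §III] -/
theorem IsProlateFunction.uniform_limits_four :
    ∀ ε : ℝ, 0 < ε → ∃ Λ : ℝ, ∀ lam : ℝ, Λ ≤ lam → ∀ f : ℝ → ℝ, IsProlateFunction lam 4 f →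
      lam * |f lam| ≤ ε ∧ (∫ x in (0 : ℝ)..lam, |f x - hermiteH4 x|) ≤ ε ∧
      (∫ x in (0 : ℝ)..lam, |deriv f x - hermiteH4' x| * (1 + x)) ≤ ε :=
  IsProlateFunction.uniform_limits (n := 4) (μ := 18 * π) (by linarith [Real.pi_gt_three])
    (fun _ hδ ↦ IsProlateFunction.eigen_tendsto_of_four hδ) hasDerivAt_hermiteH4
    hasDerivAt_hermiteH4' hermiteH4_zero_pos hermiteH4'_zero abs_hermiteH4_le
    tendsto_mul_hermiteH4_atTop tendsto_hermiteH4'_atTop tendsto_integral_sq_hermiteH4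
    tendsto_integral_abs_hermiteH4 tendsto_integral_abs_hermiteH4'_mul

/-- **Connes' Fact 6.4 (Connes 2026, §6.4; = Connes–Consani–Moscovici 2025, Lemma 7.3), proved
RH-free and asymptotics-free:** for the prolate guess `h_λ = A(h_{4,λ} − ρ_λ h_{0,λ})` built from ANY
prolate spheroidal functions `h_{0,λ}`, `h_{4,λ}` in the sense of the interface `IsProlateFunction`,
`4·M_λ(s) → Ξ(½ + s)` uniformly on `|Re s| ≤ α₀ < ½` as `λ → ∞`.  All analytic input — eigenvalue
pinning, prolate → Hermite convergence, the Mellin/ξ limit — is proved in the tree; no hypothesis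
remains. [cite: Connes2026Letter, §6.4 Fact 6.4; ConnesConsaniMoscovici2025, Lemma 7.2, Lemma 7.3] -/
theorem prolateGuess_tendsto_riemannXi_rhFree : prolateGuess_tendsto_riemannXi :=
  prolateGuess_tendsto_riemannXi_of_L1Limit
    (fun ε hε ↦ by
      obtain ⟨Λ, h⟩ := IsProlateFunction.uniform_limits_zero ε hε
      exact ⟨Λ, fun lam hl f hf ↦ (h lam hl f hf).1⟩)
    (fun ε hε ↦ by
      obtain ⟨Λ, h⟩ := IsProlateFunction.uniform_limits_four ε hε
      exact ⟨Λ, fun lam hl f hf ↦ (h lam hl f hf).1⟩)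
    (fun ε hε ↦ by
      obtain ⟨Λ, h⟩ := IsProlateFunction.uniform_limits_zero ε hε
      exact ⟨Λ, fun lam hl f hf ↦ (h lam hl f hf).2.1⟩)
    (fun ε hε ↦ by
      obtain ⟨Λ, h⟩ := IsProlateFunction.uniform_limits_four ε hε
      exact ⟨Λ, fun lam hl f hf ↦ (h lam hl f hf).2.1⟩)
    (fun ε hε ↦ by
      obtain ⟨Λ, h⟩ := IsProlateFunction.uniform_limits_zero ε hε
      exact ⟨Λ, fun lam hl f hf ↦ (h lam hl f hf).2.2⟩)
    (fun ε hε ↦ by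
      obtain ⟨Λ, h⟩ := IsProlateFunction.uniform_limits_four ε hε
      exact ⟨Λ, fun lam hl f hf ↦ (h lam hl f hf).2.2⟩)

/-- **Discharge of the named fact `prolateGuess_tendsto_riemannXi`** (Connes 2026 Letter Fact 6.4 =
Connes–Consani–Moscovici 2025 Lemma 7.3: the Mellin transform of the prolate guess `k_λ` converges to
`ξ(½ + s)` uniformly on closed substrips), under the census name `_holds`: it is the unconditional, RH-free
theorem `prolateGuess_tendsto_riemannXi_rhFree` above.  RH-FREE. [cite: ConnesConsaniMoscovici2025, Lemma 7.3] -/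
theorem prolateGuess_tendsto_riemannXi_holds : prolateGuess_tendsto_riemannXi :=
  prolateGuess_tendsto_riemannXi_rhFree

end Literature.NumberTheory.LFunctions
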